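import Summits.FinalStateConjecture.FinalStateConjecture.Theorems.ZeroEnergyKerrOrBombSymplecticDualOfTheBombSig4
import Summits.FinalStateConjecture.FinalStateConjecture.Theorems.ZeroEnergyKerrOrBombStationaryLimitReductionRecutSets
import Summits.FinalStateConjecture.FinalStateConjecture.Theorems.ZeroEnergyKerrOrBombStationaryLimitReductionKerrSchildRecut
import HarnessLib

/-!
# Route ZeroEnergyKerrOrBomb · crux `StationaryLimitReduction` (stmt-FinalStateConjecture-10021), line
# `symplectic-dual-of-the-bomb` — stub `stub_recutCovering` (r4 text, `Sig4.stub_recutCovering`), wave 3: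
# the `N = 0` case, `(init)` from `(ii)`, and the reduction to the JUNCTION

Helper file (`--supports stmt-FinalStateConjecture-10021`; registered helpers
`stub_recutCovering_of_N_eq_zero'`, `stub_recutCovering_of_transfer_of_junction`) of the lead's wave-3
stub worker for `stub_recutCovering : Sig4.stub_recutCovering` (reshape r4/r5, lead
prover-line-stmt-FinalStateConjecture-10021-a2-0, 2026-08-16). The registered text asks, for a `C²`
stationary decomposition `d` of the honest exterior `O = exteriorOf 𝒟 d.charted` which is exhaustive in
the d.o.c. sense with overlap margin (`HasExhaustiveDocCharts'`), horizon-normalised, with regular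
Kerr-charted holes (`IsKerrChartedWith`), for the causal covering clauses `KerrSchildRecutCovering 𝒟 d M a Θ`
of the naive Kerr–Schild recut (vocabulary `…SymplecticDualOfTheBombDefs2`, p114429). This file lands:

* §1 `stub_recutCovering_of_N_eq_zero'` — the registered text with the extra hypothesis `d.N = 0`
  (r4 analogue of `stub_recutCovering_of_N_eq_zero`, p116597: with no hole `d.charted = docCharted d` is
  the radiation zone and `recutCharted τ₀ = docCharted d`, so `O' = O ⊆ I⁻(docCharted d)` by the exterior
  equation and clause (ii) of `HasExhaustiveDocCharts'` is clause (ii) of the recut).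
* §2 `(init)` is implied by `(ii)`: bumping the recut time by one, the part of the (smaller) recut
  exterior not yet recut-charted is outside the recut certified late region after `τ₀' + 1`, hence in
  `J⁻` of the recut certified slab at `τ₀' + 1 ⊆` the recut initial slabs
  (`kerrSchildRecutCovering_body_of_ii`; the set inclusions `recutCertifiedLate ⊆ recutCharted`,
  `recutCertifiedSlab ⊆ recutInitialSlabs` without the binder `hmaps`).
* §3 the two residual obligations as precise `Prop`s on EXPOSED radii `R` (the witness of
  `HasExhaustiveDocCharts' d`): `RecutGrowingTransfer` (L1: `C²` convergence of the recut charts on the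
  GROWING truncated Kerr–Schild slabs of radius `Rᵢ(cᵢ τ − s) − W`, all large `s, W` — the target of
  the companion file `…RecutCoveringGrowingTransfer.lean` of this wave) and `RecutJunction` (L2: clause
  (ii) of the recut for the same radii after some late recut time — the flat/Kerr–Schild slab JUNCTION,
  absent from tree and print), and the registered reduction
  `stub_recutCovering_of_transfer_of_junction : RecutGrowingTransfer → RecutJunction → Sig4.stub_recutCovering`.

Elementary; no named fact, nothing restated. References: Dafermos–Luk arXiv:1710.01722, Conjecture 1
(b)–(c); O'Neill 1983, Ch. 14, pp. 402–403.
-/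

-- every `Summit.FinalStateConjecture.FinalStateConjecture.…` name repeats the summit = sub-problem segment (D-0017 layout)
set_option linter.dupNamespace false

noncomputable section

open scoped Manifold ContDiff Topology ENNReal
open Set Filter Function Literature.Geometry.Lorentzian

namespace Summit.FinalStateConjecture.FinalStateConjecture.Theorems.SymplecticDualOfTheBomb

open Summit.FinalStateConjecture.FinalStateConjecture.Theorems.OneLockedExplosion

/-! ## §1 The case of no hole (r4 hypotheses) -/

section NoHole

variable {𝓢 : Spacetime.{0} 4} {O : Set 𝓢.carrier} {k : ℕ}

/-- With no hole the charted late region of `d` is the d.o.c.-charted region (both are the radiation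
zone). [folklore] -/
theorem charted_eq_docCharted_of_isEmpty (d : StationaryFinalStateDecomposition 𝓢 O k)
    [IsEmpty (Fin d.N)] : d.charted = docCharted d := by
  simp only [StationaryFinalStateDecomposition.charted, FinalStateDecompositionOver.charted, docCharted,
    iUnion_of_empty, union_empty]

end NoHole

/-- **Registered helper `stub_recutCovering_of_N_eq_zero'`**: the registered r4 text of
`stub_recutCovering` (`Sig4.stub_recutCovering`) with the extra hypothesis `d.N = 0`. With no hole the
recut at `τ₀' := τ₀` changes nothing: `recutCharted τ₀ = docCharted d = d.charted` (the radiation zone),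
so `O' = O`; `(init)` is the covering clause `diff_subset_causalPast` of `d`; and since the exterior
equation puts `O` inside `I⁻(d.charted) = I⁻(docCharted d)`, clause (ii) of `HasExhaustiveDocCharts' d`
(source `O ∩ I⁻(docCharted d)`) is clause (ii) of the recut (flat parts only on both sides). [folklore] -/
theorem stub_recutCovering_of_N_eq_zero' : ∀ (X : Type) [TopologicalSpace X] [ChartedSpace E3 X] [IsManifold (𝓡 3) ∞ X] [T2Space X] [SecondCountableTopology X] [ConnectedSpace X] (D : InitialDataSet (𝓡 3) X) (𝒟 : VacuumCauchyDevelopment D) (O : Set 𝒟.carrier) (d : StationaryFinalStateDecomposition 𝒟.toSpacetime O 2) (M a c r₀ : Fin d.N → ℝ) (Θ : Fin d.N → E4 → E4), d.N = 0 → O = Summit.FinalStateConjecture.exteriorOf 𝒟.toCauchyDevelopment d.charted → HasExhaustiveDocCharts' d → IsHorizonNormalised d → (∀ i, (d.hole i).horizon ⊆ Set.range (d.adapted i).toFun ∧ ChartIsAsymptoticallyCartesian (d.adapted i) ∧ InTelescope (d.hole i)) → (∀ i, IsKerrChartedWith (d.hole i) (d.adapted i) (M i) (a i) (c i) (r₀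 i) (Θ i)) → KerrSchildRecutCovering 𝒟 d M a Θ := by
  intro X _ _ _ _ _ _ D 𝒟 O d M a c r₀ Θ hN hO hex _ _ _ hmaps
  haveI : IsEmpty (Fin d.N) := ⟨fun i ↦ (Fin.cast hN i).elim0⟩
  obtain ⟨R, -, -, -, -, hcov⟩ := hex
  have hOI : O ⊆ O ∩ 𝒟.metric.chronologicalPast 𝒟.timeOrientation (docCharted d) := fun p hp ↦ by
    refine ⟨hp, ?_⟩
    rw [← charted_eq_docCharted_of_isEmpty d]
    rw [hO] at hp
    exact hp.2
  refine ⟨d.toOver.τ₀, fun _ _ ↦ 0, le_rfl, fun i ↦ isEmptyElim i, fun i ↦ isEmptyElim i, ?_, ?_⟩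
  · rw [recutCharted_eq_docCharted_of_isEmpty, ← charted_eq_docCharted_of_isEmpty d, ← hO,
      charted_eq_docCharted_of_isEmpty d, ← recutCharted_eq_docCharted_of_isEmpty d M a Θ]
    exact diff_recutCharted_subset_of_isEmpty d M a Θ
  · intro τ₁ hτ₁
    rw [recutCharted_eq_docCharted_of_isEmpty, ← charted_eq_docCharted_of_isEmpty d, ← hO,
      recutCertifiedLate_eq_docCertifiedLate_of_isEmpty d M a Θ R,
      recutCertifiedSlab_eq_docCertifiedSlab_of_isEmpty d M a Θ R]
    exact fun p hp ↦ hcov τ₁ hτ₁ ⟨hOI hp.1, hp.2⟩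

/-! ## §2 `(init)` from `(ii)` by bumping the recut time -/

section Bump

variable {𝓢 : Spacetime.{0} 4} {O : Set 𝓢.carrier} {k : ℕ}
  (d : StationaryFinalStateDecomposition 𝓢 O k) (M a : Fin d.N → ℝ) (Θ : Fin d.N → E4 → E4)

/-- The recut certified late region after `τ₁` lies in the recut charted late region of `τ₁` (stated on
`recutImage`, without the binder `hmaps`). [folklore] -/
theorem recutCertifiedLate_subset_recutCharted (R' : Fin d.N → ℝ → ℝ) (τ₁ : ℝ) :
    recutCertifiedLate d M a Θ R' τ₁ ⊆ recutCharted d M a Θ τ₁ :=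
  union_subset_union le_rfl
    (iUnion_mono fun i ↦ recutImage_mono d Θ i (image_mono fun _ hx ↦ hx.1))

/-- The recut certified slab at `τ₁` lies in the recut initial slabs at `τ₁`. [folklore] -/
theorem recutCertifiedSlab_subset_recutInitialSlabs (R' : Fin d.N → ℝ → ℝ) (τ₁ : ℝ) :
    recutCertifiedSlab d M a Θ R' τ₁ ⊆ recutInitialSlabs d M a Θ τ₁ :=
  union_subset_union le_rfl (iUnion_mono fun i ↦ recutImage_mono d Θ i
    (image_mono ((recutBackground d M a i).truncTimeSlab_subset_timeSlab _ _)))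

end Bump

section BumpExterior

variable {X : Type} [TopologicalSpace X] [ChartedSpace E3 X] [IsManifold (𝓡 3) ∞ X]
  [ConnectedSpace X] {D : InitialDataSet (𝓡 3) X}

/-- **`(init)` from `(ii)`.** If clause (ii) of the recut holds for every `τ₁ > τ₀'` (source the recut
exterior of `τ₀'`), then at the bumped recut time `τ₀' + 1` both `(init)` and `(ii)` hold: the recut
exterior shrinks (`exteriorOf_mono`, `recutCharted_anti`), a point of it outside `recutCharted (τ₀' + 1)`
is outside `recutCertifiedLate R' (τ₀' + 1)`, and the recut certified slab lies in the recut initial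
slabs. [folklore] -/
theorem recut_init_and_ii_of_ii (𝒟 : CauchyDevelopment D) {O : Set 𝒟.carrier} {k : ℕ}
    (d : StationaryFinalStateDecomposition 𝒟.toSpacetime O k) (M a : Fin d.N → ℝ)
    (Θ : Fin d.N → E4 → E4) (R' : Fin d.N → ℝ → ℝ) (τ₀' : ℝ)
    (hii : ∀ τ₁ : ℝ, τ₀' < τ₁ →
      Summit.FinalStateConjecture.exteriorOf 𝒟 (recutCharted d M a Θ τ₀') \ recutCertifiedLate d M a Θ R' τ₁ ⊆
        𝒟.metric.causalPast 𝒟.timeOrientation (recutCertifiedSlab d M a Θ R' τ₁)) :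
    (Summit.FinalStateConjecture.exteriorOf 𝒟 (recutCharted d M a Θ (τ₀' + 1)) \
        recutCharted d M a Θ (τ₀' + 1) ⊆
      𝒟.metric.causalPast 𝒟.timeOrientation (recutInitialSlabs d M a Θ (τ₀' + 1))) ∧
    ∀ τ₁ : ℝ, τ₀' + 1 < τ₁ →
      Summit.FinalStateConjecture.exteriorOf 𝒟 (recutCharted d M a Θ (τ₀' + 1)) \
          recutCertifiedLate d M a Θ R' τ₁ ⊆
        𝒟.metric.causalPast 𝒟.timeOrientation (recutCertifiedSlab d M a Θ R' τ₁) := by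
  have hanti := exteriorOf_mono 𝒟 (recutCharted_anti d M a Θ (le_add_of_nonneg_right zero_le_one :
    τ₀' ≤ τ₀' + 1))
  refine ⟨fun p hp ↦ ?_, fun τ₁ hτ₁ p hp ↦ hii τ₁ ((lt_add_one τ₀').trans hτ₁) ⟨hanti hp.1, hp.2⟩⟩
  exact LorentzianMetric.causalFuture_mono (recutCertifiedSlab_subset_recutInitialSlabs d M a Θ R' _)
    (hii (τ₀' + 1) (lt_add_one τ₀')
      ⟨hanti hp.1, fun h ↦ hp.2 (recutCertifiedLate_subset_recutCharted d M a Θ R' _ h)⟩)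

end BumpExterior

/-! ## §3 The two residual obligations on exposed radii, and the reduction -/

/-- **L1 · growing-radius `C²` transfer** (target of `…RecutCoveringGrowingTransfer.lean`): for a smooth
late chart `ψ` of a hole read in the moved adapted chart `A`, a Kerr identification `Θ` with asymptotic
control (`IsKerrChartedWith`), and MONOTONE radii `R` out to which the `C²` truncated slab deviations of
`ψ` from the moved adapted background tend to `0`, the recut chart `ψ ∘ recutMap Θ` has `C²` truncated
slab deviations from boosted Kerr tending to `0` out to the radii `R (c τ − s) − W`, for all `s, W`
beyond a threshold (tilt, radial distortion and the derivatives of `Θ` of orders `1–3` are bounded on the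
whole exterior; the pointwise pullback estimate `norm_iteratedFDeriv_bilinPullback_le`).
(ref: DafermosLuk2017, Conjecture 1 (c)) -/
def RecutGrowingTransfer : Prop :=
  ∀ (𝓢 : Spacetime.{0} 4) (𝓑 : StationaryAFBlackHole.{0}) (A : 𝓑.AdaptedChart) (Λ : lorentzGroup) (c₀ : E4)
    (M a c r₀ : ℝ) (Θ : E4 → E4) (ψ : (A.background.boost Λ c₀).domain → 𝓢.carrier)
    (hmaps : Set.MapsTo (recutMap Λ c₀ Θ) ((boostedKerrBackground Λ c₀ M a).domain : Set E4)
      ((A.background.boost Λ c₀).domain : Set E4)) (R : ℝ → ℝ),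
    ContMDiff 𝓘(ℝ, E4) (𝓡 4) ∞ ψ → IsKerrChartedWith 𝓑 A M a c r₀ Θ → Monotone R →
    Tendsto (fun σ ↦ 𝓢.truncDeviationCk (A.background.boost Λ c₀) ψ 2 (R σ) σ) atTop (𝓝 0) →
    ∃ s₀ : ℝ, ∀ s W : ℝ, s₀ ≤ s → s₀ ≤ W →
      Tendsto (fun τ ↦ 𝓢.truncDeviationCk (boostedKerrBackground Λ c₀ M a)
        (fun y ↦ ψ ⟨recutMap Λ c₀ Θ y.1, hmaps y.2⟩) 2 (R (c * τ - s) - W) τ) atTop (𝓝 0)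

/-- **L2 · the junction** (clause (ii) of the recut at the transported radii; ABSENT from tree and print):
under the hypotheses of `Sig4.stub_recutCovering` with the radii `R` of `HasExhaustiveDocCharts' d` exposed,
for all `s, W` beyond a threshold there is a late recut time `τ₀' ≥ τ₀` such that for every `τ₁ > τ₀'`
the part of the recut exterior `exteriorOf 𝒟 (recutCharted τ₀')` outside the recut certified late region
of radii `Rᵢ (cᵢ τ − s) − W` lies in the causal past of the recut certified slab at `τ₁`: the flat and
Kerr–Schild slab families JOIN on the overlap annuli (margin clause (iii) makes the shell between the
transported radius and the old one flat-charted), old certified points between the old slab at chart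
time `τ₁` and the Kerr–Schild slab at `t* = τ₁` (tilt `≤ L`) are pushed onto the latter where the late
metric is `C⁰`-close to Kerr, and the near-horizon strip (no uniform timelike margin) is handled by
horizon normalisation. (ref: DafermosLuk2017, Conjecture 1 (b)–(c)) -/
def RecutJunction : Prop :=
  ∀ (X : Type) [TopologicalSpace X] [ChartedSpace E3 X] [IsManifold (𝓡 3) ∞ X]
    [T2Space X] [SecondCountableTopology X] [ConnectedSpace X] (D : InitialDataSet (𝓡 3) X)
    (𝒟 : VacuumCauchyDevelopment D) (O : Set 𝒟.carrier)
    (d : StationaryFinalStateDecomposition 𝒟.toSpacetime O 2)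
    (M a c r₀ : Fin d.N → ℝ) (Θ : Fin d.N → E4 → E4) (R : Fin d.N → ℝ → ℝ),
    O = Summit.FinalStateConjecture.exteriorOf 𝒟.toCauchyDevelopment d.charted →
    (∀ i, Tendsto (fun τ ↦ 𝒟.toSpacetime.truncDeviationCk (d.background i) (d.toOver.chart i) 2 (R i τ) τ)
      atTop (𝓝 0)) →
    (∀ i, Monotone (R i)) → (∀ i, Tendsto (R i) atTop atTop) →
    (∀ i, ∀ W s₀ : ℝ, ∀ᶠ σ in atTop,
      d.toOver.chart i '' ({x | (d.background i).time x.1 = σ ∧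
        R i (σ - s₀) - W ≤ (d.background i).radius x.1} ∩ docPart d i) ⊆ d.toOver.radiationZone) →
    (∀ τ₁ : ℝ, d.toOver.τ₀ < τ₁ →
      (O ∩ 𝒟.metric.chronologicalPast 𝒟.timeOrientation (docCharted d)) \ docCertifiedLate d R τ₁ ⊆
        𝒟.metric.causalPast 𝒟.timeOrientation (docCertifiedSlab d R τ₁)) →
    IsHorizonNormalised d →
    (∀ i, (d.hole i).horizon ⊆ Set.range (d.adapted i).toFun ∧
      ChartIsAsymptoticallyCartesian (d.adapted i) ∧ InTelescope (d.hole i)) →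
    (∀ i, IsKerrChartedWith (d.hole i) (d.adapted i) (M i) (a i) (c i) (r₀ i) (Θ i)) →
    ∃ s₁ : ℝ, ∀ s W : ℝ, s₁ ≤ s → s₁ ≤ W → ∃ τ₀' : ℝ, d.toOver.τ₀ ≤ τ₀' ∧ ∀ τ₁ : ℝ, τ₀' < τ₁ →
      Summit.FinalStateConjecture.exteriorOf 𝒟.toCauchyDevelopment (recutCharted d M a Θ τ₀') \
          recutCertifiedLate d M a Θ (fun i τ ↦ R i (c i * τ - s) - W) τ₁ ⊆
        𝒟.metric.causalPast 𝒟.timeOrientation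
          (recutCertifiedSlab d M a Θ (fun i τ ↦ R i (c i * τ - s) - W) τ₁)

/-- Transported radii grow: `R (c τ − s) − W → ∞` if `R → ∞` and `c > 0`. [folklore] -/
theorem tendsto_transportedRadius {R : ℝ → ℝ} (hR : Tendsto R atTop atTop) {c : ℝ} (hc : 0 < c)
    (s W : ℝ) : Tendsto (fun τ ↦ R (c * τ - s) - W) atTop atTop :=
  tendsto_atTop_add_const_right _ _
    (hR.comp (tendsto_atTop_add_const_right _ _ (Tendsto.const_mul_atTop hc tendsto_id)))

/-- **Registered helper `stub_recutCovering_of_transfer_of_junction`: the reduction of the stub to the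
junction.** `Sig4.stub_recutCovering` follows from L1 (`RecutGrowingTransfer`) and L2
(`RecutJunction`): expose the radii `R` of `HasExhaustiveDocCharts' d`; take `s = W` beyond the thresholds of
L1 (for every hole) and of L2; the radii `R'ᵢ τ = Rᵢ (cᵢ τ − s) − W` tend to `∞`, carry the `C²`
convergence (L1) and clause (ii) after the recut time of L2, and `(init)` follows by bumping that time by
one (`recut_init_and_ii_of_ii`). [folklore] -/
theorem stub_recutCovering_of_transfer_of_junction : RecutGrowingTransfer → RecutJunction → Sig4.stub_recutCovering := by
  intro hL1 hL2 X _ _ _ _ _ _ D 𝒟 O d M a c r₀ Θ hO hex hnorm hreg hW hmaps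
  obtain ⟨R, hRi, hRmono, hRtop, hRiii, hRii⟩ := hex
  have h1 := fun i ↦ hL1 𝒟.toSpacetime (d.hole i) (d.adapted i) (d.motion i).1 (d.motion i).2 (M i) (a i)
    (c i) (r₀ i) (Θ i) (d.toOver.chart i) (hmaps i) (R i) (d.toOver.isLateChart i).contMDiff (hW i)
    (hRmono i) (hRi i)
  choose s₀ hs₀ using h1
  obtain ⟨s₁, hs₁⟩ := hL2 X D 𝒟 O d M a c r₀ Θ R hO hRi hRmono hRtop hRiii hRii hnorm hreg hW
  obtain ⟨S, hS⟩ := Finite.exists_le s₀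
  set s : ℝ := max s₁ S with hs
  obtain ⟨τ₀', hτ₀', hii⟩ := hs₁ s s (le_max_left _ _) (le_max_left _ _)
  obtain ⟨hinit, hii'⟩ := recut_init_and_ii_of_ii 𝒟.toCauchyDevelopment d M a Θ
    (fun i τ ↦ R i (c i * τ - s) - s) τ₀' hii
  refine ⟨τ₀' + 1, fun i τ ↦ R i (c i * τ - s) - s, hτ₀'.trans (le_add_of_nonneg_right zero_le_one),
    fun i ↦ tendsto_transportedRadius (hRtop i) (hW i).2.1 s s,
    fun i ↦ hs₀ i s s ((hS i).trans (le_max_right _ _)) ((hS i).trans (le_max_right _ _)), hinit, hii'⟩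

end Summit.FinalStateConjecture.FinalStateConjecture.Theorems.SymplecticDualOfTheBomb

end
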